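import Summits.NavierStokesRegularity.NavierStokesRegularity.Theorems.AdaptedFrequencyAdaptedKernelExistsKernelLimit
import Mathlib.Analysis.Distribution.AEEqOfIntegralContDiff
import HarnessLib

/-!
# Crux `FrequencyRigidity` (stmt-NavierStokesRegularity-2955), line `moving-adjoint-bernoulli`:
  STUB `stub_kernelCompactness` (S4), part 1 — extraction along growing windows

Helper file (lands `--supports stmt-NavierStokesRegularity-2955`; proves the registered sub-goal
`stub_kernelCompactness_extract`) on the proof path of the registered stub
`stub_kernelCompactness` (compactness of adapted kernels of ONE smooth divergence-free locally
bounded drift `v` on `(−∞, 0) × ℝ³`, given on the growing windows `[−n−1, 0)` with pole `(0, 0)`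
and squeezed between two fixed Gaussians).  This file extracts a subsequence converging at EVERY
`(t, x)`, `t < 0`:

* `kernelCompactness_sup_bound` — the common Gaussian upper envelope bounds every kernel by
  `C₁ (−t₂)^{-3/2}` up to time `t₂ < 0`;
* `kernelCompactness_space_modulus` — spatial equicontinuity at `(t, x)` of all the kernels whose
  window has reached `t` (`kernelLimit_space_modulus` on the block `[t, t/2]`);
* `kernelCompactness_pairing_lipschitz` — the pairings `t ↦ ∫ψKₙ(t)` are Lipschitz on compact
  sub-intervals with ONE constant (`kernelLimit_pairing_lipschitz`, common local drift bound);
* `kernelCompactness_extract` — ONE application of the abstract extraction lemma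
  `kernelLimit_extract` on the bounded interval `(0, 1)` to the time-changed family
  `(s, x) ↦ Kₙ(max (1 − 1/s) (−n − 1/2), x)` (frozen below the time `−n − 1/2`, where it is still
  a kernel slice, so that ALL members satisfy the hypotheses); no diagonal argument is needed,
  and at a fixed `t < 0` the frozen times of the subsequence eventually equal `t`.
-/

set_option linter.dupNamespace false

noncomputable section

open MeasureTheory Set Filter Topology Metric Function
open scoped Laplacian ContDiff
open Literature.Analysis.FluidPDE
open Summit.NavierStokesRegularity.NavierStokesRegularity.Theorems.AdaptedKernelExists.NashEntropyLastBlock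

namespace Summit.NavierStokesRegularity.NavierStokesRegularity.Theorems.FrequencyRigidity.MovingAdjointBernoulli

/-! ### Uniform estimates along the family -/

/-- A finite family of positive reals has a positive lower bound. -/
theorem kernelCompactness_exists_pos_le (d : ℕ → ℝ) (hd : ∀ n, 0 < d n) :
    ∀ N : ℕ, ∃ δ : ℝ, 0 < δ ∧ ∀ n, n < N → δ ≤ d n
  | 0 => ⟨1, one_pos, fun n hn => absurd hn (Nat.not_lt_zero n)⟩
  | N + 1 => by
      obtain ⟨δ, hδ, h⟩ := kernelCompactness_exists_pos_le d hd N
      refine ⟨min δ (d N), lt_min hδ (hd N), fun n hn => ?_⟩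
      rcases Nat.lt_succ_iff_lt_or_eq.1 hn with h' | rfl
      · exact (min_le_left _ _).trans (h n h')
      · exact min_le_right _ _

/-- Eventually the windows `[−φ(k) − 1, 0)` of a subsequence start strictly before any fixed
time. -/
theorem kernelCompactness_eventually_lt {φ : ℕ → ℕ} (hφ : StrictMono φ) (t : ℝ) :
    ∀ᶠ k in atTop, -(φ k : ℝ) - 1 < t := by
  obtain ⟨N, hN⟩ := exists_nat_gt (-t - 1)
  refine eventually_atTop.2 ⟨N, fun k hk => ?_⟩
  have hkφ : k ≤ φ k := hφ.id_le k
  have : (N:ℝ) ≤ φ k := by exact_mod_cast hk.trans hkφ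
  linarith

/-- **Uniform sup bound.**  A kernel of the family below the common Gaussian upper envelope is
bounded by `C₁ (−t₂)^{-3/2}` on its window up to time `t₂ < 0`. -/
theorem kernelCompactness_sup_bound {ν C₁ C₂ : ℝ}
    {v : ℝ → EuclideanSpace ℝ (Fin 3) → EuclideanSpace ℝ (Fin 3)}
    {K : ℕ → ℝ → EuclideanSpace ℝ (Fin 3) → ℝ} (hC₁ : 0 < C₁) (hC₂ : 0 < C₂)
    (hK : ∀ n : ℕ, IsAdaptedBackwardKernel ν v (Ico (-(n:ℝ) - 1) 0) 0 0 (K n))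
    (hKU : ∀ n : ℕ, ∀ t ∈ Ico (-(n:ℝ) - 1) (0:ℝ), ∀ x,
      K n t x ≤ C₁ * ((0:ℝ) - t) ^ (-(3:ℝ) / 2) *
        Real.exp (-(‖x - (0 : EuclideanSpace ℝ (Fin 3))‖ ^ 2) / (C₂ * ((0:ℝ) - t))))
    {t₂ : ℝ} (ht₂ : t₂ < 0) (n : ℕ) {t : ℝ} (ht : t ∈ Icc (-(n:ℝ) - 1) t₂)
    (x : EuclideanSpace ℝ (Fin 3)) : |K n t x| ≤ C₁ * ((0:ℝ) - t₂) ^ (-(3:ℝ) / 2) := by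
  have htI : t ∈ Ico (-(n:ℝ) - 1) (0:ℝ) := ⟨ht.1, ht.2.trans_lt ht₂⟩
  have h0t : 0 < (0:ℝ) - t := by linarith [ht.2]
  rw [abs_of_pos ((hK n).pos t htI x)]
  refine (hKU n t htI x).trans ?_
  have h1 : Real.exp (-(‖x - (0 : EuclideanSpace ℝ (Fin 3))‖ ^ 2) / (C₂ * ((0:ℝ) - t))) ≤ 1 := by
    rw [Real.exp_le_one_iff, neg_div]
    have : 0 ≤ ‖x - (0 : EuclideanSpace ℝ (Fin 3))‖ ^ 2 / (C₂ * ((0:ℝ) - t)) := by positivity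
    linarith
  have h2 : ((0:ℝ) - t) ^ (-(3:ℝ) / 2) ≤ ((0:ℝ) - t₂) ^ (-(3:ℝ) / 2) :=
    Real.rpow_le_rpow_of_nonpos (by linarith) (by linarith [ht.2]) (by norm_num)
  have h3 : 0 ≤ C₁ * ((0:ℝ) - t) ^ (-(3:ℝ) / 2) := by positivity
  calc C₁ * ((0:ℝ) - t) ^ (-(3:ℝ) / 2) *
        Real.exp (-(‖x - (0 : EuclideanSpace ℝ (Fin 3))‖ ^ 2) / (C₂ * ((0:ℝ) - t)))
      ≤ C₁ * ((0:ℝ) - t) ^ (-(3:ℝ) / 2) * 1 := mul_le_mul_of_nonneg_left h1 h3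
    _ ≤ C₁ * ((0:ℝ) - t₂) ^ (-(3:ℝ) / 2) := by
        rw [mul_one]; exact mul_le_mul_of_nonneg_left h2 hC₁.le

/-- **Spatial equicontinuity of the family** at a point `(t, x)`, `t < 0`: one radius `δ` serves
all the kernels `Kₙ` whose window starts before `t` (`kernelLimit_space_modulus` on the block
`[t, t/2]`, where the drift bound and the Gaussian sup bound are common). -/
theorem kernelCompactness_space_modulus {ν C₁ C₂ : ℝ}
    {v : ℝ → EuclideanSpace ℝ (Fin 3) → EuclideanSpace ℝ (Fin 3)}
    {K : ℕ → ℝ → EuclideanSpace ℝ (Fin 3) → ℝ} (hν : 0 < ν) (hC₁ : 0 < C₁) (hC₂ : 0 < C₂)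
    (hv : IsSmoothSpaceTimeOn (Iio 0) v)
    (hbd : ∀ a b : ℝ, a < b → b < 0 → ∃ B : ℝ, ∀ t ∈ Icc a b, ∀ x, ‖v t x‖ ≤ B)
    (hK : ∀ n : ℕ, IsAdaptedBackwardKernel ν v (Ico (-(n:ℝ) - 1) 0) 0 0 (K n))
    (hKU : ∀ n : ℕ, ∀ t ∈ Ico (-(n:ℝ) - 1) (0:ℝ), ∀ x,
      K n t x ≤ C₁ * ((0:ℝ) - t) ^ (-(3:ℝ) / 2) *
        Real.exp (-(‖x - (0 : EuclideanSpace ℝ (Fin 3))‖ ^ 2) / (C₂ * ((0:ℝ) - t))))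
    {t : ℝ} (ht : t < 0) (x : EuclideanSpace ℝ (Fin 3)) {ε : ℝ} (hε : 0 < ε) :
    ∃ δ : ℝ, 0 < δ ∧ ∀ n : ℕ, -(n:ℝ) - 1 < t →
      ∀ y, ‖y - x‖ ≤ δ → |K n t y - K n t x| ≤ ε := by
  set τ : ℝ := ((0:ℝ) - t) / 2 with hτ
  have hτ0 : 0 < τ := by rw [hτ]; linarith
  have htT : t + τ < 0 := by rw [hτ]; linarith
  obtain ⟨B, hB⟩ := hbd t (t + τ) (by linarith) htT
  set Bd : ℝ := max B 0 with hBd_def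
  have hBd0 : 0 ≤ Bd := le_max_right _ _
  have hBd : ∀ s ∈ Icc t (t + τ), ∀ z, ‖v s z‖ ≤ Bd := fun s hs z =>
    (hB s hs z).trans (le_max_left _ _)
  set M : ℝ := C₁ * ((0:ℝ) - (t + τ)) ^ (-(3:ℝ) / 2) with hM
  have hM0 : 0 < M := by
    rw [hM]
    have : 0 < (0:ℝ) - (t + τ) := by linarith
    positivity
  have hGM : ∀ n : ℕ, -(n:ℝ) - 1 < t → ∀ s ∈ Icc t (t + τ), ∀ z, |K n s z| ≤ M :=
    fun n hn s hs z => kernelCompactness_sup_bound hC₁ hC₂ hK hKU htT n ⟨hn.le.trans hs.1, hs.2⟩ z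
  set ρ : ℝ := Real.sqrt (ν * τ) with hρ
  have hρ0 : 0 < ρ := Real.sqrt_pos.2 (mul_pos hν hτ0)
  have hρτ : ρ ^ 2 ≤ ν * τ := by rw [hρ, Real.sq_sqrt (mul_pos hν hτ0).le]
  have hA : 0 ≤ Bd / ν := div_nonneg hBd0 hν.le
  have hLc : 0 < lipConst (Bd / ν) ρ (Module.finrank ℝ (EuclideanSpace ℝ (Fin 3))) :=
    lipConst_pos hA hρ0 (Nat.cast_nonneg _)
  refine ⟨min (lipRad (Bd / ν) ρ)
      (ε / (lipConst (Bd / ν) ρ (Module.finrank ℝ (EuclideanSpace ℝ (Fin 3))) * M + 1)),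
    lt_min (lipRad_pos hA hρ0) (by positivity), fun n hn y hy => ?_⟩
  exact kernelLimit_space_modulus hν hn hτ0 htT (hv.mono Ico_subset_Iio_self) hBd hBd0
    (hK n) hM0 (hGM n hn) hρ0 hρτ hε x y hy

/-- **Equicontinuity in time of the pairings, uniformly along the family.**  For a compactly
supported smooth `ψ` and `t₁ ≤ t₂ < 0` there is `L ≥ 0` with
`|∫ψKₙ(t) − ∫ψKₙ(s)| ≤ L|t − s|` for `s, t ∈ [a, t₂]` whenever `t₁ ≤ a` and the window of `Kₙ`
starts before `a` (`kernelLimit_pairing_lipschitz`; the constant depends only on a drift bound on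
`[t₁ − 1, t₂]`). -/
theorem kernelCompactness_pairing_lipschitz {ν : ℝ}
    {v : ℝ → EuclideanSpace ℝ (Fin 3) → EuclideanSpace ℝ (Fin 3)}
    {K : ℕ → ℝ → EuclideanSpace ℝ (Fin 3) → ℝ} (hν : 0 < ν)
    (hv : IsSmoothSpaceTimeOn (Iio 0) v)
    (hdiv : ∀ t ∈ Iio (0:ℝ), VectorCalculus.IsDivFree (v t))
    (hbd : ∀ a b : ℝ, a < b → b < 0 → ∃ B : ℝ, ∀ t ∈ Icc a b, ∀ x, ‖v t x‖ ≤ B)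
    (hK : ∀ n : ℕ, IsAdaptedBackwardKernel ν v (Ico (-(n:ℝ) - 1) 0) 0 0 (K n))
    {ψ : EuclideanSpace ℝ (Fin 3) → ℝ} (hψ : ContDiff ℝ ∞ ψ) (hψc : HasCompactSupport ψ)
    {t₁ t₂ : ℝ} (h₁₂ : t₁ ≤ t₂) (h₂ : t₂ < 0) :
    ∃ L : ℝ, 0 ≤ L ∧ ∀ n : ℕ, ∀ a : ℝ, -(n:ℝ) - 1 < a → t₁ ≤ a →
      ∀ s ∈ Icc a t₂, ∀ t ∈ Icc a t₂,
        |(∫ x, ψ x * K n t x) - ∫ x, ψ x * K n s x| ≤ L * |t - s| := by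
  obtain ⟨B, hB⟩ := hbd (t₁ - 1) t₂ (by linarith) h₂
  set A : ℝ := max B 0 with hA_def
  have hA0 : 0 ≤ A := le_max_right _ _
  have hψ2 : ContDiff ℝ 2 ψ := hψ.of_le (by norm_cast)
  obtain ⟨M₁, hM₁⟩ := (hψ2.continuous_fderiv (by norm_num)).bounded_above_of_compact_support
    (hψc.fderiv (𝕜 := ℝ))
  have hΔc : HasCompactSupport (Δ ψ) :=
    HasCompactSupport.intro hψc (fun x hx => laplacian_eq_zero_of_notMem_tsupport hx)
  obtain ⟨M₂, hM₂⟩ := (continuous_laplacian hψ2).bounded_above_of_compact_support hΔc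
  have hM₁0 : 0 ≤ M₁ := (norm_nonneg _).trans (hM₁ 0)
  have hM₂0 : 0 ≤ M₂ := (norm_nonneg _).trans (hM₂ 0)
  refine ⟨A * M₁ + ν * M₂, add_nonneg (mul_nonneg hA0 hM₁0) (mul_nonneg hν.le hM₂0),
    fun n a hna h₁a s hs t ht => ?_⟩
  have hIco : Ico (-(n:ℝ) - 1) 0 ⊆ Iio 0 := Ico_subset_Iio_self
  exact kernelLimit_pairing_lipschitz hν.le (hv.mono hIco) (fun r hr => hdiv r (hIco hr)) (hK n)
    hψ2 hψc hna h₂ hA0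
    (fun r hr x _ => (hB r ⟨by linarith [hr.1], hr.2⟩ x).trans (le_max_left _ _))
    hM₁ (fun x => by rw [← Real.norm_eq_abs]; exact hM₂ x) hs ht

/-! ### Extraction -/

/-- **Extraction of a subsequence converging at every point of `(−∞, 0) × ℝ³`.**  One
application of `kernelLimit_extract` on `(0, 1)` to the time-changed family
`Gₙ(s, x) = Kₙ(max (1 − 1/s) (−n − 1/2), x)`: each slice is a genuine kernel slice (nonnegative,
continuous, mass one); the pairings are Lipschitz in `s` on compact sub-intervals uniformly in `n`
(`kernelCompactness_pairing_lipschitz`, the time change being Lipschitz there and the freezing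
`max · (−n − 1/2)` being `1`-Lipschitz); the slices are equicontinuous
(`kernelCompactness_space_modulus` for the kernels whose window has reached the time, plain
continuity for the finitely many others).  At `t < 0` the frozen times eventually equal `t`. -/
theorem kernelCompactness_extract {ν C₁ C₂ : ℝ}
    {v : ℝ → EuclideanSpace ℝ (Fin 3) → EuclideanSpace ℝ (Fin 3)}
    {K : ℕ → ℝ → EuclideanSpace ℝ (Fin 3) → ℝ} (hν : 0 < ν) (hC₁ : 0 < C₁) (hC₂ : 0 < C₂)
    (hv : IsSmoothSpaceTimeOn (Iio 0) v)
    (hdiv : ∀ t ∈ Iio (0:ℝ), VectorCalculus.IsDivFree (v t))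
    (hbd : ∀ a b : ℝ, a < b → b < 0 → ∃ B : ℝ, ∀ t ∈ Icc a b, ∀ x, ‖v t x‖ ≤ B)
    (hK : ∀ n : ℕ, IsAdaptedBackwardKernel ν v (Ico (-(n:ℝ) - 1) 0) 0 0 (K n))
    (hKU : ∀ n : ℕ, ∀ t ∈ Ico (-(n:ℝ) - 1) (0:ℝ), ∀ x,
      K n t x ≤ C₁ * ((0:ℝ) - t) ^ (-(3:ℝ) / 2) *
        Real.exp (-(‖x - (0 : EuclideanSpace ℝ (Fin 3))‖ ^ 2) / (C₂ * ((0:ℝ) - t)))) :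
    ∃ φ : ℕ → ℕ, StrictMono φ ∧ ∃ Glim : ℝ → EuclideanSpace ℝ (Fin 3) → ℝ,
      ∀ t < (0:ℝ), ∀ x, Tendsto (fun k => K (φ k) t x) atTop (𝓝 (Glim t x)) := by
  -- the time change `σ(s) = 1 - 1/s : (0, 1) → (-∞, 0)`, frozen below `-n - 1/2`
  set θ : ℕ → ℝ → ℝ := fun n s => max (1 - 1 / s) (-(n:ℝ) - 1 / 2) with hθ_def
  set Gs : ℕ → ℝ → EuclideanSpace ℝ (Fin 3) → ℝ := fun n s x => K n (θ n s) x with hGs_def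
  have hσ_neg : ∀ s ∈ Ioo (0:ℝ) 1, 1 - 1 / s < 0 := fun s hs => by
    have : 1 < 1 / s := by rw [lt_div_iff₀ hs.1]; linarith [hs.2]
    linarith
  have hθ_gt : ∀ (n : ℕ) (s : ℝ), -(n:ℝ) - 1 < θ n s := fun n s => by
    have h : -(n:ℝ) - 1 / 2 ≤ θ n s := le_max_right _ _
    linarith
  have hθI : ∀ n : ℕ, ∀ s ∈ Ioo (0:ℝ) 1, θ n s ∈ Ico (-(n:ℝ) - 1) 0 := fun n s hs => by
    refine ⟨(hθ_gt n s).le, ?_⟩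
    show max (1 - 1 / s) (-(n:ℝ) - 1 / 2) < 0
    exact max_lt (hσ_neg s hs) (by linarith [(Nat.cast_nonneg n : (0:ℝ) ≤ n)])
  have hcont : ∀ n, ∀ s ∈ Ioo (0:ℝ) 1, Continuous (Gs n s) := fun n s hs =>
    ((hK n).contDiff_slice (hθI n s hs)).continuous
  have hpos : ∀ n, ∀ s ∈ Ioo (0:ℝ) 1, ∀ x, 0 ≤ Gs n s x := fun n s hs x =>
    ((hK n).pos _ (hθI n s hs) x).le
  have hint : ∀ n, ∀ s ∈ Ioo (0:ℝ) 1, Integrable (Gs n s) := fun n s hs =>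
    (hK n).integrable (hθI n s hs)
  have hmass : ∀ n, ∀ s ∈ Ioo (0:ℝ) 1, ∫ x, Gs n s x ≤ 1 := fun n s hs =>
    ((hK n).integral_eq_one _ (hθI n s hs)).le
  -- equicontinuity in time of the pairings
  have hequi_t : ∀ ψ : EuclideanSpace ℝ (Fin 3) → ℝ, ContDiff ℝ ∞ ψ → HasCompactSupport ψ →
      ∀ s₁ s₂ : ℝ, 0 < s₁ → s₂ < 1 → ∃ L : ℝ, ∀ n, ∀ s ∈ Icc s₁ s₂, ∀ s' ∈ Icc s₁ s₂,
        |(∫ x, ψ x * Gs n s' x) - ∫ x, ψ x * Gs n s x| ≤ L * |s' - s| := by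
    intro ψ hψ hψc s₁ s₂ hs₁ hs₂
    rcases le_or_gt s₁ s₂ with h12 | h21
    swap
    · exact ⟨0, fun n s hs s' _ => absurd (hs.1.trans hs.2) (not_le.2 h21)⟩
    have hs₂0 : 0 < s₂ := hs₁.trans_le h12
    set t₁ : ℝ := 1 - 1 / s₁ with ht₁
    set t₂ : ℝ := 1 - 1 / s₂ with ht₂
    have ht₁₂ : t₁ ≤ t₂ := by
      have := one_div_le_one_div_of_le hs₁ h12
      rw [ht₁, ht₂]; linarith
    have ht₂0 : t₂ < 0 := hσ_neg s₂ ⟨hs₂0, hs₂⟩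
    obtain ⟨L, hL0, hL⟩ :=
      kernelCompactness_pairing_lipschitz hν hv hdiv hbd hK hψ hψc ht₁₂ ht₂0
    refine ⟨L / s₁ ^ 2, fun n s hs s' hs' => ?_⟩
    have hs0 : 0 < s := hs₁.trans_le hs.1
    have hs'0 : 0 < s' := hs₁.trans_le hs'.1
    -- the time change is `1/s₁²`-Lipschitz on `[s₁, s₂]`, and so is the frozen time
    have hσ : |(1 - 1 / s') - (1 - 1 / s)| ≤ |s' - s| / s₁ ^ 2 := by
      have hs0' : s ≠ 0 := hs0.ne'
      have hs'0' : s' ≠ 0 := hs'0.ne'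
      have e : (1 - 1 / s') - (1 - 1 / s) = (s' - s) / (s * s') := by
        field_simp
        ring
      rw [e, abs_div, abs_of_pos (mul_pos hs0 hs'0)]
      exact div_le_div_of_nonneg_left (abs_nonneg _) (by positivity)
        (by rw [sq]; exact mul_le_mul hs.1 hs'.1 hs₁.le hs0.le)
    have hθs : |θ n s' - θ n s| ≤ |s' - s| / s₁ ^ 2 :=
      (abs_max_sub_max_le_abs _ _ _).trans hσ
    have hσmono : ∀ r ∈ Icc s₁ s₂, 1 - 1 / r ∈ Icc t₁ t₂ := fun r hr => by
      have h1 := one_div_le_one_div_of_le hs₁ hr.1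
      have h2 := one_div_le_one_div_of_le (hs₁.trans_le hr.1) hr.2
      constructor
      · linarith [ht₁]
      · linarith [ht₂]
    have hRHS : L * |θ n s' - θ n s| ≤ L / s₁ ^ 2 * |s' - s| := by
      calc L * |θ n s' - θ n s| ≤ L * (|s' - s| / s₁ ^ 2) := mul_le_mul_of_nonneg_left hθs hL0
        _ = L / s₁ ^ 2 * |s' - s| := by ring
    by_cases hfr : -(n:ℝ) - 1 / 2 ≤ t₂
    · set a : ℝ := max t₁ (-(n:ℝ) - 1 / 2) with ha
      have hna : -(n:ℝ) - 1 < a := by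
        have h : -(n:ℝ) - 1 / 2 ≤ a := le_max_right _ _
        linarith
      have h₁a : t₁ ≤ a := le_max_left _ _
      have hθmem : ∀ r ∈ Icc s₁ s₂, θ n r ∈ Icc a t₂ := fun r hr =>
        ⟨max_le_max (hσmono r hr).1 le_rfl, max_le (hσmono r hr).2 hfr⟩
      exact (hL n a hna h₁a (θ n s) (hθmem s hs) (θ n s') (hθmem s' hs')).trans hRHS
    · push Not at hfr
      have hθfr : ∀ r ∈ Icc s₁ s₂, θ n r = -(n:ℝ) - 1 / 2 := fun r hr =>
        max_eq_right ((hσmono r hr).2.trans hfr.le)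
      show |(∫ x, ψ x * K n (θ n s') x) - ∫ x, ψ x * K n (θ n s) x| ≤ L / s₁ ^ 2 * |s' - s|
      rw [hθfr s hs, hθfr s' hs', sub_self, abs_zero]
      exact mul_nonneg (div_nonneg hL0 (sq_nonneg _)) (abs_nonneg _)
  -- equicontinuity in space
  have hequi_x : ∀ s ∈ Ioo (0:ℝ) 1, ∀ x : EuclideanSpace ℝ (Fin 3), ∀ ε : ℝ, 0 < ε →
      ∃ δ : ℝ, 0 < δ ∧ ∀ n (y : EuclideanSpace ℝ (Fin 3)), ‖y - x‖ ≤ δ →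
        |Gs n s y - Gs n s x| ≤ ε := by
    intro s hs x ε hε
    set t : ℝ := 1 - 1 / s with ht_def
    have ht : t < 0 := hσ_neg s hs
    obtain ⟨N, hN⟩ := exists_nat_ge (-t)
    obtain ⟨δu, hδu, hmod⟩ := kernelCompactness_space_modulus hν hC₁ hC₂ hv hbd hK hKU ht x hε
    have hd : ∀ n, ∃ d : ℝ, 0 < d ∧ ∀ y, ‖y - x‖ ≤ d → |Gs n s y - Gs n s x| ≤ ε := by
      intro n
      obtain ⟨d, hd, h⟩ := Metric.continuous_iff.1 (hcont n s hs) x ε hε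
      refine ⟨d / 2, by positivity, fun y hy => le_of_lt ?_⟩
      have := h y (by rw [dist_eq_norm]; linarith)
      rwa [Real.dist_eq] at this
    choose d hd0 hd using hd
    obtain ⟨δf, hδf, hδf_le⟩ := kernelCompactness_exists_pos_le d hd0 N
    refine ⟨min δu δf, lt_min hδu hδf, fun n y hy => ?_⟩
    rcases Nat.lt_or_ge n N with hn | hn
    · exact hd n y ((hy.trans (min_le_right _ _)).trans (hδf_le n hn))
    · have hnt : -(n:ℝ) - 1 / 2 ≤ t := by
        have : (N:ℝ) ≤ n := by exact_mod_cast hn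
        linarith
      have hθt : θ n s = t := max_eq_left hnt
      show |K n (θ n s) y - K n (θ n s) x| ≤ ε
      rw [hθt]
      exact hmod n (by linarith) y (hy.trans (min_le_left _ _))
  obtain ⟨φ, hφ, Glim', hconv'⟩ := kernelLimit_extract hcont hpos hint hmass hequi_t hequi_x
  refine ⟨φ, hφ, fun t x => Glim' (1 / (1 - t)) x, fun t ht x => ?_⟩
  set s : ℝ := 1 / (1 - t) with hs_def
  have hs : s ∈ Ioo (0:ℝ) 1 := by
    rw [hs_def]
    exact ⟨div_pos one_pos (by linarith), (div_lt_one (by linarith)).2 (by linarith)⟩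
  have hσs : 1 - 1 / s = t := by rw [hs_def, one_div_one_div]; ring
  obtain ⟨N, hN⟩ := exists_nat_ge (-t)
  refine (hconv' s hs x).congr' ?_
  rw [EventuallyEq, eventually_atTop]
  refine ⟨N, fun k hk => ?_⟩
  have hkφ : k ≤ φ k := hφ.id_le k
  have hk' : (N:ℝ) ≤ φ k := by exact_mod_cast hk.trans hkφ
  have hθt : θ (φ k) s = t := by
    show max (1 - 1 / s) (-(φ k : ℝ) - 1 / 2) = t
    rw [hσs]
    exact max_eq_left (by linarith)
  show K (φ k) (θ (φ k) s) x = K (φ k) t x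
  rw [hθt]

/-! ### Registered sub-goal -/

/-- **Registered sub-goal `stub_kernelCompactness_extract`** (part 1 of the proof of STUB
`stub_kernelCompactness`): along a family of adapted backward kernels of one drift on the growing
windows `[−n−1, 0)` under a common Gaussian upper bound, a subsequence converges at every point of
`(−∞, 0) × ℝ³`. -/
theorem stub_kernelCompactness_extract :
    ∀ (ν C₁ C₂ : ℝ) (v : ℝ → EuclideanSpace ℝ (Fin 3) → EuclideanSpace ℝ (Fin 3)) (K : ℕ → ℝ → EuclideanSpace ℝ (Fin 3) → ℝ), 0 < ν → 0 < C₁ → 0 < C₂ → Literature.Analysis.FluidPDE.IsSmoothSpaceTimeOn (Set.Iio 0) v → (∀ t ∈ Set.Iio (0:ℝ), Literature.Analysis.FluidPDE.VectorCalculus.IsDivFree (v t)) → (∀ a b : ℝ, a < b → b < 0 → ∃ B : ℝ, ∀ t ∈ Set.Icc a b, ∀ x, ‖v t x‖ ≤ B) → (∀ n : ℕ, Literature.Analysis.FluidPDE.IsAdaptedBackwardKernel ν v (Set.Ico (-(n:ℝ) - 1) 0) 0 0 (K n)) → (∀ n : ℕ, ∀ t ∈ Set.Ico (-(n:ℝ)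 - 1) (0:ℝ), ∀ x, K n t x ≤ C₁ * ((0:ℝ) - t) ^ (-(3:ℝ) / 2) * Real.exp (-(‖x - (0 : EuclideanSpace ℝ (Fin 3))‖ ^ 2) / (C₂ * ((0:ℝ) - t)))) → ∃ φ : ℕ → ℕ, StrictMono φ ∧ ∃ Glim : ℝ → EuclideanSpace ℝ (Fin 3) → ℝ, ∀ t < (0:ℝ), ∀ x, Filter.Tendsto (fun k => K (φ k) t x) Filter.atTop (nhds (Glim t x)) :=
  fun _ _ _ _ _ hν hC₁ hC₂ hv hdiv hbd hK hKU => kernelCompactness_extract hν hC₁ hC₂ hv hdiv hbd hK hKU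

end Summit.NavierStokesRegularity.NavierStokesRegularity.Theorems.FrequencyRigidity.MovingAdjointBernoulli

end
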